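import Literature.NumberTheory.Automorphic.Liu2021.LemD1AsPrintedIndexedNonVacuityAtPlace
import Literature.NumberTheory.Automorphic.UnitaryGroupNonsplitPlace
import Literature.NumberTheory.QuadraticForms.LocalNormIndex
import Literature.NumberTheory.GelbartRogawski1991.CMSplittingCharLocalMu
import Literature.RepresentationTheory.Liu2021.OscillatorConventions
import Literature.NumberTheory.Automorphic.ConjugateSelfDualCharacters
import Literature.NumberTheory.Automorphic.IdeleClassCharacterHecke
import Literature.NumberTheory.ComplexMultiplication.CMTypeCount
import HarnessLib

/-!
# [Liu2021, App. D §D.1 Steps 1–2 and Lemma D.1 (1) ∧ (3)] as printed at the place model — THE NON-SPLIT PLACE,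
# and the CM rows' own Step-2 slot `localMu L (toHeckeCharacter L ψ) v` at EVERY place

Reproduction ∕ bookkeeping (Literature, THEOREMS ONLY: no definition, no record, no named fact, no `sorry`; nothing is
asserted about Liu's oscillator representations or about the tree's constructed local Weil carriers).

Companion of `LemD1AsPrintedIndexedNonVacuityAtPlace.lean` (the SPLIT place).  Same slot types — the tree's PLACE MODEL
of a quadratic extension `E/F` of number fields at a finite place `v` of `F` (`F_v := v.adicCompletion F`,
`E_v := UnitaryGroup.LocalRing E v = Π_{w ∣ v} E_w` with `c ⊗ 1 = UnitaryGroup.conjLocal`, `S := LemD1OfPlace.standingData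
E v c N J hcδ hδ hN hJh hJdet`, any hermitian `J` with `det J ≠ 0`, any `N ≥ 2`) — now at a place `v` that does NOT
split in `E` (one place `w ∣ v`, `c • w = w`: `v` inert or ramified), where the printed index sets of [Liu2021, App. D
§D.1] (l. 5217–5219) are GENUINE:

* §1 `E_v` IS a field (tree `UnitaryGroup.LocalRing.isField_of_smul_eq`; so the first conjunct «`E` is a field» of the
  right-hand side of Lem. D.1 (1) is TRUE for the place model at a non-split place), and `δ²` (`c δ = -δ ≠ 0`, `δ · δ = d ∈ F`)
  is NOT a square in `F_v` (`not_isSquare_delta_sq_of_nonsplit`: a square root `s` would make `δ ⊗ 1 = ± ι_v s` fixed by `c ⊗ 1`);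
* §2 Step 2: the norms `x · (c ⊗ 1) x`, `x ∈ E_vˣ`, are exactly `N(F_v(√d)ˣ) = {p² − d q²}` (`isNorm_iff_mem_quadraticNormSubgroup`,
  coordinates `E_v = ι_v F_v ⊕ ι_v F_v · (δ ⊗ 1)` of the tree's `QuadraticLocalBaseChange`), a subgroup of index EXACTLY `2` in `F_vˣ`
  (`index_norms_eq_two_of_nonsplit` ← the tree's kernel theorem `QuadraticForms.index_quadraticNormSubgroup_adicCompletion_eq_two`,
  O'Meara 63:13a, EVERY residue characteristic, no class field theory); hence a NON-NORM `a ∈ F_vˣ` exists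
  (`exists_not_isNorm_of_nonsplit`), the TRIVIAL character violates the printed clause «`μ(ι_v a) = 1 ↔ a ∈ Nm E_vˣ`»
  (`not_stepTwo_one_of_nonsplit`; contrast `one_mem_muSet_of_split`), and EVERY Step-2 datum `(μ, hμF)` — the displayed binder
  shape of the rows — has `μ(ι_v a) = −1` somewhere (`exists_apply_eq_neg_one_of_nonsplit`: `≠ 1` at the non-norm, square `1`
  because `a² = ι_v(a) · (c ⊗ 1) ι_v(a)` is a norm), so `μ ≠ 1` and `μ|_{ι_v F_vˣ}` has order exactly `2` («the unique character whose
  kernel is exactly `Nm_{E/F} E^×`» is the non-trivial one there); `MuSet` versions `exists_muSet_apply_eq_neg_one_of_nonsplit`,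
  `muSet_val_ne_one_of_nonsplit`;
* §2b Step 1: every representative `e' ∈ E_v^{−×}` is `ι_v(p) · e` for a `p ∈ F_vˣ` (`exists_epsRep_eq_map_mul`: `e' e⁻¹` is fixed
  by `c ⊗ 1`, and the fixed subalgebra is `ι_v F_v`), and `ι_v(p) · e ∼ e` iff `p` is a norm (`sameClass_map_mul_iff`).  So the
  printed index set `E^{−×}/Nm_{E/F}E^×`, read at the place model, is `F_vˣ / Nm E_vˣ`: ONE class at a split place
  (`sameClass_of_split`), EXACTLY TWO classes at a non-split place (`exists_epsRep_not_sameClass_of_nonsplit`,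
  `epsRep_two_classes_of_nonsplit` ← Mathlib `Subgroup.mul_mem_iff_of_index_two`);
* §2c the record [Lem. D.1 (3)] AS PRINTED has TEETH IN THE `ε`-SLOT at a non-split place (rank `N ≥ 3`): for any Step-2 `μ`
  and representative `e₀`, the two-member collection `(μ, e₀, 1), (μ, ι_v(a) e₀, 1)` on the trivial line passes (1) member by
  member and FAILS `LemD1_3AsPrintedI` (`exists_lemD1IndexedFamily_item1_not_lemD1_3_eps_of_nonsplit`) — at a split place the
  `ε`-conjunct of (3) never separates.

§3–§5, THE CM ROWS (`L` a CM field, `F = L⁺`, `c` = complex conjugation, `δ = imagUnit L`: the `F⁺_v ∕ L_v ∕ S ∕ ε ∕ μ` slots of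
the displayed rows `hD1''` ∕ `hD3` of the cell's END): the rows' Step-2 binder types `(μ : C_L →ₜ* S¹, hμ : IsConjugateSymplectic,
hw : HasWeight 1)` are INHABITED for every CM field (`exists_isConjugateSymplectic_hasWeight_one` ← the tree's kernel theorem
`IdeleClassGroup.exists_isConjugateSymplectic_hasCMType`, Weil's characters of type (A₀)), so AT EVERY FINITE PLACE `v` OF `L⁺`
— split, inert or ramified — the rows' own μ-slot former `localMu L (toHeckeCharacter L ψ) v` with its three displayed proofs
`norm_localMu` ∕ `continuous_localMu` ∕ `localMu_toLocalRing_eq_one_iff … ((isOscillatorChar_toHeckeCharacter_iff ψ).mpr hψ)` is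
an element of `MuSet (LemD1OfPlace.standingData L v c N J …)` (`exists_muSet_val_eq_localMu`, `nonempty_muSet_of_isCMField`) —
at a non-split place this GLOBAL supply is what inhabits Step 2 for the place model, `1 ∉ MuSet` there —; the `hD1''` type
former `LemD1_1AsPrinted (LemD1OfPlace.data L v c N J … J₁ ω μ_v … χ …)` holds at EVERY place for `N ≠ 2` with the rows' OWN
`μ_v` slot, `χ = 1`, `ω` the trivial line (`lemD1_1AsPrinted_data_trivial_localMu`,
`exists_isConjugateSymplectic_forall_lemD1_1AsPrinted_data_trivial`); the rows' own `μ_v` is `≡ 1` on `ι_v(L⁺_vˣ)` at a split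
place and `= −1` somewhere at a non-split place (§4); «(1) ∧ (3)» is jointly satisfiable at EVERY place on a collection with ALL
of `F ∕ E ∕ S ∕ ε ∕ μ` the rows' own (`exists_lemD1IndexedFamily_localMu`, any index type; (3) exercised at equal labels only), and
the `ε`-teeth of (3) bite at non-split places with the rows' own `μ_v` (`exists_lemD1IndexedFamily_item1_not_lemD1_3_eps_localMu_of_nonsplit`).

What this does NOT give: a Step-2 character of the place model at a non-split place of a GENERAL (non-CM) quadratic `E/F`
(the supply here is the global CM character); a second, DIFFERENT Step-2 character at a non-split place (`∃ x, μ_v(x)² ≠ 1` stays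
open there), hence no two-`μ`-label (1) ∧ (3) collection at a non-split place; no non-line carrier (a second irreducible admissible
representation of `U(J)(F_v)` with open stabilisers and trivial central action is not constructed); nothing about the rows' OWN
carriers `𝓢.omegaLoc v` or `χ_v = localCharOfCenter …`; items (2)∕(4); Lem. D.1 itself.  HC_CM is NOT proved.

Cell pub-hodgecm2 (COR-CM), audit class of the END rows `hD1''` ∕ `hD3`; seat prover-pub-hodgecm2-b10.

References: [Liu2021] Y. Liu, *Fourier–Jacobi cycles and arithmetic relative trace formula*, Camb. J. Math. 9 (2021) =
arXiv:2102.11518, App. D §D.1 Steps 1–3 (`FJcycle.tex` l. 5213–5224), Lemma D.1 (1) (l. 5229), (3)–(4) (l. 5233–5235), Def. 4.1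
(l. 1900–1902), Def. 4.3, Def. 4.11 (l. 2086); [Omeara1963] O. T. O'Meara, *Introduction to Quadratic Forms* (1963), §63B
Cor. 63:13a (the local norm index `2`); [CasselsFrohlichANT1967] Ch. II §10 (`L ⊗_K K_v = Π_{w∣v} L_w`), Ch. VII Prop. 1.2
(one place above a non-split `v`).
-/

noncomputable section

open scoped Matrix MatrixGroups
open NumberField IsDedekindDomain
open Literature.RepresentationTheory
open Literature.RepresentationTheory.Liu2021 (OscillatorStandingData)
open Literature.RepresentationTheory.CentralCharacterQuotient (augmentation quotRep quotRep_mk)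
open Literature.NumberTheory.QuadraticForms (quadraticNormSubgroup mem_quadraticNormSubgroup_iff
  index_quadraticNormSubgroup_adicCompletion_eq_two)

namespace Literature.NumberTheory.Automorphic.Liu2021.LemD1IndexedNonVacuityNonsplitPlace

open UnitaryGroup

section General

variable {F : Type} (E : Type) [Field F] [NumberField F] [Field E] [NumberField E] [Algebra F E]
  [Algebra.IsQuadraticExtension F E] (v : HeightOneSpectrum (𝓞 F)) (c : E ≃ₐ[F] E)
  {δ : E} (hcδ : c δ = -δ) (hδ : δ ≠ 0)

/-! ## §1 The place model `E_v = E ⊗_F F_v` at a NON-split place: a field in which `δ²` has no square root in `F_v` -/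

omit [NumberField F] [Algebra.IsQuadraticExtension F E] in
include hcδ hδ in
/-- `c ≠ 1`: an automorphism negating some `δ ≠ 0` is not the identity (characteristic `0`). [folklore] -/
private theorem hc_of_delta : c ≠ 1 := by
  rintro rfl
  rw [AlgEquiv.one_apply] at hcδ
  have h2 : (2 : E) * δ = 0 := by linear_combination hcδ
  exact hδ ((mul_eq_zero.mp h2).resolve_left two_ne_zero)

include hcδ hδ in
/-- **«`E` is a field» HOLDS for the place model at a non-split place**: if `w ∣ v` is fixed by `c` (so `w` is the only
place above `v`), `E_v = Π_{w' ∣ v} E_{w'} = E_w` is a field (tree `LocalRing.isField_of_smul_eq`; `c ≠ 1` because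
`c δ = -δ ≠ 0`).  So at a non-split place the first conjunct of the right-hand side of [Liu2021, Lem. D.1 (1)] is TRUE for
the place model — in contrast with the split case (`LemD1IndexedNonVacuityAtPlace.not_isField_localRing_of_split`).
[cite: Liu2021, App. D Lemma D.1 (1) (l. 5229)] [cite: CasselsFrohlichANT1967, Ch. II §10] -/
theorem isField_localRing_of_nonsplit (w : PlacesOver E v) (hw : c • w.1 = w.1) : IsField (LocalRing E v) :=
  LocalRing.isField_of_smul_eq c (hc_of_delta E c hcδ hδ) w hw

include hcδ hδ in
/-- `δ² ∈ F`: for a quadratic `E/F` and `c δ = -δ ≠ 0` there is `d ∈ F` with `δ · δ = d` (write `δ² = x + y δ` in the basis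
`1, δ`; applying `c` gives `y = 0`). [folklore] -/
private theorem exists_delta_mul_self_eq_algebraMap : ∃ d : F, δ * δ = algebraMap F E d := by
  obtain ⟨x, y, hxy⟩ := exists_eq_add_mul_of_isQuadraticExtension (F := F) (E := E)
    (not_mem_range_algebraMap_of_apply_eq_neg E c hcδ hδ) (δ * δ)
  have hc2 : c (δ * δ) = δ * δ := by rw [map_mul, hcδ, neg_mul_neg]
  have hy : algebraMap F E y * δ = 0 := by
    have h1 : c (δ * δ) = algebraMap F E x - algebraMap F E y * δ := by
      rw [hxy, map_add, map_mul, AlgEquiv.commutes, AlgEquiv.commutes, hcδ, mul_neg, sub_eq_add_neg]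
    rw [hc2, hxy] at h1
    have h2 : (2 : E) * (algebraMap F E y * δ) = 0 := by linear_combination h1
    exact (mul_eq_zero.1 h2).resolve_left two_ne_zero
  exact ⟨x, by rw [hxy, hy, add_zero]⟩

omit [Algebra.IsQuadraticExtension F E] in
/-- `(δ ⊗ 1)² = ι_v(d)` in `E_v` when `δ² = d ∈ F`. [cite: CasselsFrohlichANT1967, Ch. II §10] -/
private theorem algebraMap_delta_mul_self {d : F} (hd : δ * δ = algebraMap F E d) :
    algebraMap E (LocalRing E v) δ * algebraMap E (LocalRing E v) δ = toLocalRing E v (d : v.adicCompletion F) := by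
  rw [← map_mul, hd, toLocalRing_coe]

include hcδ hδ in
/-- **at a non-split place `δ²` is NOT a square in `F_v`** (`δ · δ = d ∈ F`): in the FIELD `E_v` (§1) a square root
`s ∈ F_v` of `d` would give `(δ ⊗ 1 - ι_v s)(δ ⊗ 1 + ι_v s) = 0`, so `δ ⊗ 1 = ± ι_v s` would be fixed by `c ⊗ 1`, whereas
`(c ⊗ 1)(δ ⊗ 1) = -δ ⊗ 1 ≠ 0`.  (Equivalently `E_w = F_v(δ)` is a quadratic field extension of `F_v`.)
[cite: CasselsFrohlichANT1967, Ch. II §10] [cite: Omeara1963, §63B] -/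
theorem not_isSquare_delta_sq_of_nonsplit (w : PlacesOver E v) (hw : c • w.1 = w.1) {d : F}
    (hd : δ * δ = algebraMap F E d) : ¬ IsSquare (d : v.adicCompletion F) := by
  rintro ⟨s, hs⟩
  have hF : IsField (LocalRing E v) := isField_localRing_of_nonsplit E v c hcδ hδ w hw
  letI := hF.toField
  set δv : LocalRing E v := algebraMap E (LocalRing E v) δ with hδvdef
  have hδv2 : δv * δv = toLocalRing E v s * toLocalRing E v s := by
    rw [hδvdef, algebraMap_delta_mul_self E v hd, hs, map_mul]
  have hprod : (δv - toLocalRing E v s) * (δv + toLocalRing E v s) = 0 := by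
    rw [show (δv - toLocalRing E v s) * (δv + toLocalRing E v s) = δv * δv - toLocalRing E v s * toLocalRing E v s by ring,
      hδv2, sub_self]
  have hconjδ : conjLocal E c v δv = -δv := by rw [hδvdef, conjLocal_algebraMap, hcδ, map_neg]
  have hfix : conjLocal E c v δv = δv := by
    rcases mul_eq_zero.1 hprod with h | h
    · rw [sub_eq_zero] at h
      rw [h, conjLocal_toLocalRing]
    · rw [add_eq_zero_iff_eq_neg] at h
      rw [h, map_neg, conjLocal_toLocalRing]
  rw [hconjδ] at hfix
  have h0 : δ = 0 := by
    refine CharZero.neg_eq_self_iff.1 ((algebraMap E (LocalRing E v)).injective ?_)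
    rw [map_neg]
    exact hfix
  exact hδ h0

/-! ## §2 Step 2 at a non-split place: a non-norm exists; the trivial character is NOT a Step-2 character; every
Step-2 character is `-1` somewhere on `ι_v(F_vˣ)` -/

include hcδ hδ in
/-- **norms from `E_vˣ` in coordinates** (every place): for `δ · δ = d ∈ F`, a unit `a ∈ F_vˣ` is a norm `x · (c ⊗ 1) x` of a
unit `x ∈ E_vˣ` iff `a = p² - d q²` for some `p, q ∈ F_v`, i.e. iff `a` lies in the norm group `N(F_v(√d)ˣ)` of the tree's
quadratic-forms library (`QuadraticForms.quadraticNormSubgroup`): `x = ι_v p + ι_v q · (δ ⊗ 1)` has `x · (c ⊗ 1) x = ι_v(p² - d q²)`.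
[cite: Liu2021, App. D §D.1 Step 2 (l. 5219)] [cite: Omeara1963, §63B] -/
theorem isNorm_iff_mem_quadraticNormSubgroup {d : F} (hd : δ * δ = algebraMap F E d) (a : (v.adicCompletion F)ˣ) :
    (∃ x : (LocalRing E v)ˣ, (x : LocalRing E v) * conjLocal E c v x = algebraMap (v.adicCompletion F) (LocalRing E v) a) ↔
      a ∈ quadraticNormSubgroup (v.adicCompletion F) (d : v.adicCompletion F) := by
  -- the norm form in coordinates
  have key : ∀ p q : v.adicCompletion F,
      (toLocalRing E v p + toLocalRing E v q * algebraMap E (LocalRing E v) δ) *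
          conjLocal E c v (toLocalRing E v p + toLocalRing E v q * algebraMap E (LocalRing E v) δ) =
        toLocalRing E v (p ^ 2 - (d : v.adicCompletion F) * q ^ 2) := by
    intro p q
    rw [map_add, map_mul, conjLocal_toLocalRing, conjLocal_toLocalRing, conjLocal_algebraMap, hcδ, map_neg, map_sub,
      map_pow, map_mul, map_pow, ← algebraMap_delta_mul_self E v hd]
    ring
  constructor
  · rintro ⟨x, hx⟩
    obtain ⟨⟨p, q⟩, hpq, -⟩ := existsUnique_eq_add_mul E v c hcδ hδ (x : LocalRing E v)
    dsimp only at hpq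
    refine mem_quadraticNormSubgroup_iff.2 ⟨p, q, ?_⟩
    rw [algebraMap_localRing_eq, hpq, key] at hx
    exact toLocalRing_injective E v hx
  · intro ha
    obtain ⟨p, q, hpq⟩ := mem_quadraticNormSubgroup_iff.1 ha
    set x₀ : LocalRing E v := toLocalRing E v p + toLocalRing E v q * algebraMap E (LocalRing E v) δ with hx₀
    have hx₀n : x₀ * conjLocal E c v x₀ = algebraMap (v.adicCompletion F) (LocalRing E v) a := by
      rw [hx₀, key, hpq, algebraMap_localRing_eq]
    have hu : IsUnit x₀ := by
      refine isUnit_of_mul_isUnit_left (y := conjLocal E c v x₀) ?_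
      rw [hx₀n]
      exact a.isUnit.map _
    exact ⟨hu.unit, by rw [IsUnit.unit_spec, hx₀n]⟩

include hcδ hδ in
/-- **at a non-split place some `a ∈ F_vˣ` is NOT a norm `x · (c ⊗ 1) x` from `E_vˣ`** — the right-hand side of the
printed Step-2 clause «`μ|_{F^×}` has kernel exactly `Nm_{E/F} E^×`» is a GENUINE condition there (contrast: at a split place
every `a` is a norm, `LemD1IndexedNonVacuityAtPlace.exists_mul_conjLocal_eq_algebraMap_of_split`).  Proof: `δ² = d` is not a
square in `F_v` (§1), so the norm group `N(F_v(√d)ˣ) = {p² - d q²}` has index `2` in `F_vˣ` (tree kernel theorem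
`QuadraticForms.index_quadraticNormSubgroup_adicCompletion_eq_two`, O'Meara 63:13a, every residue characteristic); and a norm
`x · (c ⊗ 1) x`, `x = ι_v p + ι_v q · (δ ⊗ 1)`, IS `ι_v(p² - d q²)`. [cite: Liu2021, App. D §D.1 Step 2 (l. 5219)]
[cite: Omeara1963, §63B Cor. 63:13a] -/
theorem exists_not_isNorm_of_nonsplit (w : PlacesOver E v) (hw : c • w.1 = w.1) :
    ∃ a : (v.adicCompletion F)ˣ, ¬ ∃ x : (LocalRing E v)ˣ, (x : LocalRing E v) * conjLocal E c v x =
      algebraMap (v.adicCompletion F) (LocalRing E v) a := by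
  obtain ⟨d, hd⟩ := exists_delta_mul_self_eq_algebraMap E c hcδ hδ
  have hd0E : algebraMap F E d ≠ 0 := by rw [← hd]; exact mul_ne_zero hδ hδ
  have hd0 : d ≠ 0 := fun h => hd0E (by rw [h, map_zero])
  have hd0v : (d : v.adicCompletion F) ≠ 0 := (map_ne_zero (algebraMap F (v.adicCompletion F))).2 hd0
  have hidx := index_quadraticNormSubgroup_adicCompletion_eq_two F v hd0v
    (not_isSquare_delta_sq_of_nonsplit E v c hcδ hδ w hw hd)
  have hne : quadraticNormSubgroup (v.adicCompletion F) (d : v.adicCompletion F) ≠ ⊤ := by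
    intro h
    rw [h, Subgroup.index_top] at hidx
    exact absurd hidx (by norm_num)
  obtain ⟨a, ha⟩ : ∃ a : (v.adicCompletion F)ˣ, a ∉ quadraticNormSubgroup (v.adicCompletion F) (d : v.adicCompletion F) := by
    by_contra hall
    exact hne ((Subgroup.eq_top_iff' _).2 fun a => by
      by_contra ha
      exact hall ⟨a, ha⟩)
  exact ⟨a, fun h => ha ((isNorm_iff_mem_quadraticNormSubgroup E v c hcδ hδ hd a).1 h)⟩

include hcδ hδ in
/-- **the norms from `E_vˣ` form a subgroup of index EXACTLY `2` in `F_vˣ` at a non-split place** (`δ · δ = d`):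
`{a | ∃ x ∈ E_vˣ, x · (c ⊗ 1) x = ι_v a} = N(F_v(√d)ˣ)` (`isNorm_iff_mem_quadraticNormSubgroup`) has index `2` — the local
norm index theorem of the tree's quadratic-forms library at a non-square `d` (§1). [cite: Omeara1963, §63B Cor. 63:13a]
[cite: Liu2021, App. D §D.1 Step 2 (l. 5219)] -/
theorem index_norms_eq_two_of_nonsplit (w : PlacesOver E v) (hw : c • w.1 = w.1) {d : F}
    (hd : δ * δ = algebraMap F E d) :
    (quadraticNormSubgroup (v.adicCompletion F) (d : v.adicCompletion F)).index = 2 := by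
  have hd0E : algebraMap F E d ≠ 0 := by rw [← hd]; exact mul_ne_zero hδ hδ
  have hd0 : d ≠ 0 := fun h => hd0E (by rw [h, map_zero])
  have hd0v : (d : v.adicCompletion F) ≠ 0 := (map_ne_zero (algebraMap F (v.adicCompletion F))).2 hd0
  exact index_quadraticNormSubgroup_adicCompletion_eq_two F v hd0v (not_isSquare_delta_sq_of_nonsplit E v c hcδ hδ w hw hd)

include hcδ hδ in
/-- **the TRIVIAL character is NOT a Step-2 character at a non-split place**: `μ = 1` violates the printed clause
«`μ(ι_v a) = 1 ↔ a ∈ Nm E_vˣ`» at the non-norm `a` of `exists_not_isNorm_of_nonsplit` (left side true, right side false) —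
in contrast with the split case (`LemD1IndexedNonVacuityAtPlace.one_mem_muSet_of_split`). [cite: Liu2021, App. D §D.1 Step 2 (l. 5219)] -/
theorem not_stepTwo_one_of_nonsplit (w : PlacesOver E v) (hw : c • w.1 = w.1) :
    ¬ ∀ a : (v.adicCompletion F)ˣ,
        (1 : (LocalRing E v)ˣ →* ℂˣ) (Units.map (algebraMap (v.adicCompletion F) (LocalRing E v)).toMonoidHom a) = 1 ↔
          ∃ x : (LocalRing E v)ˣ, (x : LocalRing E v) * conjLocal E c v x =
            algebraMap (v.adicCompletion F) (LocalRing E v) a := by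
  obtain ⟨a, ha⟩ := exists_not_isNorm_of_nonsplit E v c hcδ hδ w hw
  exact fun h => ha ((h a).1 (MonoidHom.one_apply _))

omit [Algebra.IsQuadraticExtension F E] in
/-- `ι_v(a) · (c ⊗ 1)(ι_v a) = ι_v(a²)`: the unit `a · a` of `F_v` IS a norm from `E_vˣ` (at every place).
[cite: Liu2021, App. D §D.1 Step 2 (l. 5219)] -/
private theorem units_map_mul_conjLocal (a : (v.adicCompletion F)ˣ) :
    ((Units.map (algebraMap (v.adicCompletion F) (LocalRing E v)).toMonoidHom a : (LocalRing E v)ˣ) : LocalRing E v) *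
        conjLocal E c v (Units.map (algebraMap (v.adicCompletion F) (LocalRing E v)).toMonoidHom a : (LocalRing E v)ˣ) =
      algebraMap (v.adicCompletion F) (LocalRing E v) ((a * a : (v.adicCompletion F)ˣ) : v.adicCompletion F) := by
  rw [Units.coe_map, RingHom.toMonoidHom_eq_coe, MonoidHom.coe_coe, algebraMap_localRing_eq, conjLocal_toLocalRing,
    Units.val_mul, map_mul]

include hcδ hδ in
/-- **every Step-2 datum `μ` at a non-split place takes the value `-1` on `ι_v(F_vˣ)`**: for `μ : E_vˣ → ℂˣ` satisfying
the printed clause «`μ(ι_v a) = 1 ↔ a ∈ Nm E_vˣ`» (the displayed binder `hμF` of the rows, nothing else is used) there is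
`a ∈ F_vˣ` with `μ(ι_v a) = -1`: at the non-norm `a` of `exists_not_isNorm_of_nonsplit` the clause gives `μ(ι_v a) ≠ 1`,
while `μ(ι_v a)² = μ(ι_v a²) = 1` because `a² = ι_v(a) · (c ⊗ 1) ι_v(a)` is a norm.  So `μ|_{ι_v(F_vˣ)}` has order EXACTLY
`2` at a non-split place — «the unique character whose kernel is exactly `Nm_{E/F} E^×`» is the NON-trivial one there.
[cite: Liu2021, App. D §D.1 Step 2 (l. 5219)] [cite: Omeara1963, §63B Cor. 63:13a] -/
theorem exists_apply_eq_neg_one_of_nonsplit (w : PlacesOver E v) (hw : c • w.1 = w.1) (μ : (LocalRing E v)ˣ →* ℂˣ)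
    (hμF : ∀ a : (v.adicCompletion F)ˣ,
      μ (Units.map (algebraMap (v.adicCompletion F) (LocalRing E v)).toMonoidHom a) = 1 ↔
        ∃ x : (LocalRing E v)ˣ, (x : LocalRing E v) * conjLocal E c v x =
          algebraMap (v.adicCompletion F) (LocalRing E v) a) :
    ∃ a : (v.adicCompletion F)ˣ, μ (Units.map (algebraMap (v.adicCompletion F) (LocalRing E v)).toMonoidHom a) = -1 := by
  obtain ⟨a, ha⟩ := exists_not_isNorm_of_nonsplit E v c hcδ hδ w hw
  refine ⟨a, ?_⟩
  have hne : μ (Units.map (algebraMap (v.adicCompletion F) (LocalRing E v)).toMonoidHom a) ≠ 1 :=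
    fun h => ha ((hμF a).1 h)
  have hsq : μ (Units.map (algebraMap (v.adicCompletion F) (LocalRing E v)).toMonoidHom a) ^ 2 = 1 := by
    rw [sq, ← map_mul, ← map_mul]
    exact (hμF (a * a)).2 ⟨_, units_map_mul_conjLocal E v c a⟩
  have h2 : (((μ (Units.map (algebraMap (v.adicCompletion F) (LocalRing E v)).toMonoidHom a) : ℂˣ) : ℂ)) ^ 2 = 1 := by
    rw [← Units.val_pow_eq_pow_val, hsq, Units.val_one]
  rcases sq_eq_one_iff.1 h2 with h | h
  · exact absurd (Units.ext h) hne
  · exact Units.ext (by rw [h, Units.val_neg, Units.val_one])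

include hcδ hδ in
/-- **… in particular `μ ≠ 1`** for every Step-2 datum at a non-split place. [cite: Liu2021, App. D §D.1 Step 2 (l. 5219)] -/
theorem ne_one_of_stepTwo_of_nonsplit (w : PlacesOver E v) (hw : c • w.1 = w.1) (μ : (LocalRing E v)ˣ →* ℂˣ)
    (hμF : ∀ a : (v.adicCompletion F)ˣ,
      μ (Units.map (algebraMap (v.adicCompletion F) (LocalRing E v)).toMonoidHom a) = 1 ↔
        ∃ x : (LocalRing E v)ˣ, (x : LocalRing E v) * conjLocal E c v x =
          algebraMap (v.adicCompletion F) (LocalRing E v) a) :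
    μ ≠ 1 := by
  obtain ⟨a, ha⟩ := exists_apply_eq_neg_one_of_nonsplit E v c hcδ hδ w hw μ hμF
  rintro rfl
  rw [MonoidHom.one_apply] at ha
  have h := congrArg (fun u : ℂˣ => (u : ℂ)) ha
  simp only [Units.val_one, Units.val_neg] at h
  norm_num at h

variable (N : ℕ) (J : Matrix (Fin N) (Fin N) E) (hN : 2 ≤ N) (hJh : (J.map c)ᵀ = J) (hJdet : J.det ≠ 0)

/-- **every Step-2 character of the place model at a non-split place is non-trivial on `ι_v(F_vˣ)`**: for
`μ ∈ MuSet (LemD1OfPlace.standingData …)` there is `a ∈ F_vˣ` with `μ(ι_v a) ≠ 1` (the non-norm of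
`exists_not_isNorm_of_nonsplit`, through the printed clause). [cite: Liu2021, App. D §D.1 Step 2 (l. 5219)] -/
theorem exists_muSet_apply_ne_one_of_nonsplit (w : PlacesOver E v) (hw : c • w.1 = w.1)
    (μ : LemD1.MuSet (LemD1OfPlace.standingData E v c N J hcδ hδ hN hJh hJdet)) :
    ∃ a : (v.adicCompletion F)ˣ,
      μ.1 (Units.map (algebraMap (v.adicCompletion F) (LocalRing E v)).toMonoidHom a) ≠ 1 := by
  obtain ⟨a, ha⟩ := exists_not_isNorm_of_nonsplit E v c hcδ hδ w hw
  exact ⟨a, fun h => ha ((μ.2.2.2 a).1 h)⟩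

/-- **… and takes the value `-1` there**: `μ(ι_v a)² = 1` for every Step-2 character (`a² = a · a^c` is a norm,
`LemD1IndexedNonVacuityAtPlace.muSet_apply_algebraMap_sq`) and `μ(ι_v a) ≠ 1` at a non-norm, so `μ(ι_v a) = -1`: at a
non-split place `μ|_{ι_v(F_vˣ)}` is a character of order EXACTLY `2` — «the unique character whose kernel is exactly
`Nm_{E/F} E^×`» is the non-trivial one. [cite: Liu2021, App. D §D.1 Step 2 (l. 5219)] [cite: Omeara1963, §63B Cor. 63:13a] -/
theorem exists_muSet_apply_eq_neg_one_of_nonsplit (w : PlacesOver E v) (hw : c • w.1 = w.1)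
    (μ : LemD1.MuSet (LemD1OfPlace.standingData E v c N J hcδ hδ hN hJh hJdet)) :
    ∃ a : (v.adicCompletion F)ˣ,
      μ.1 (Units.map (algebraMap (v.adicCompletion F) (LocalRing E v)).toMonoidHom a) = -1 :=
  exists_apply_eq_neg_one_of_nonsplit E v c hcδ hδ w hw μ.1 μ.2.2.2

/-- **no Step-2 character of the place model at a non-split place is trivial** (`μ ≠ 1` in `MuSet S`).
[cite: Liu2021, App. D §D.1 Step 2 (l. 5219)] -/
theorem muSet_val_ne_one_of_nonsplit (w : PlacesOver E v) (hw : c • w.1 = w.1)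
    (μ : LemD1.MuSet (LemD1OfPlace.standingData E v c N J hcδ hδ hN hJh hJdet)) : μ.1 ≠ 1 :=
  ne_one_of_stepTwo_of_nonsplit E v c hcδ hδ w hw μ.1 μ.2.2.2

/-! ## §2b Step 1 at the place model: every representative is an `F_vˣ`-multiple of a given one — ONE `ε`-class at a
split place, EXACTLY TWO `ε`-classes at a non-split place -/

include hcδ hδ in
/-- an element of `E_v` fixed by `c ⊗ 1` lies in `ι_v(F_v)` (coordinates `ι_v p + ι_v q · (δ ⊗ 1)`: fixed means `2 ι_v q · (δ ⊗ 1) = 0`,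
and `2`, `δ ⊗ 1` are units). [cite: CasselsFrohlichANT1967, Ch. II §10] -/
private theorem exists_eq_toLocalRing_of_conjLocal_eq (x : LocalRing E v) (hx : conjLocal E c v x = x) :
    ∃ p : v.adicCompletion F, x = toLocalRing E v p := by
  haveI : CharZero (v.adicCompletion F) := charZero_of_injective_algebraMap (algebraMap F _).injective
  obtain ⟨⟨p, q⟩, hpq, -⟩ := existsUnique_eq_add_mul E v c hcδ hδ x
  dsimp only at hpq
  have hconj : conjLocal E c v x = toLocalRing E v p - toLocalRing E v q * algebraMap E (LocalRing E v) δ := by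
    rw [hpq, map_add, map_mul, conjLocal_toLocalRing, conjLocal_toLocalRing, conjLocal_algebraMap, hcδ, map_neg]
    ring
  have h2 : toLocalRing E v 2 * (toLocalRing E v q * algebraMap E (LocalRing E v) δ) = 0 := by
    have h := hx
    rw [hconj, hpq] at h
    rw [map_ofNat]
    linear_combination -h
  have h2u : IsUnit (toLocalRing E v 2) := (isUnit_iff_ne_zero.2 (two_ne_zero : (2 : v.adicCompletion F) ≠ 0)).map _
  have hδu : IsUnit (algebraMap E (LocalRing E v) δ) := (isUnit_iff_ne_zero.2 hδ).map _
  have hq : toLocalRing E v q * algebraMap E (LocalRing E v) δ = 0 := (h2u.mul_right_eq_zero).1 h2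
  rw [mul_comm] at hq
  have hq' : toLocalRing E v q = 0 := (hδu.mul_right_eq_zero).1 hq
  exact ⟨p, by rw [hpq, hq', zero_mul, add_zero]⟩

/-- a Step-1 representative is negated by `c ⊗ 1`: `(c ⊗ 1) e = -e`. [cite: Liu2021, App. D §D.1 Step 1 (l. 5217)] -/
private theorem conjLocal_epsRep (e : LemD1.EpsRep (LemD1OfPlace.standingData E v c N J hcδ hδ hN hJh hJdet)) :
    conjLocal E c v (e.1 : LocalRing E v) = -(e.1 : LocalRing E v) :=
  eq_neg_of_add_eq_zero_right (((LemD1OfPlace.standingData E v c N J hcδ hδ hN hJh hJdet).mem_skew_iff _).1 e.2)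

/-- **`ι_v(p) · e` is again a Step-1 representative** for `p ∈ F_vˣ` (`ι_v(p)` is fixed by `c ⊗ 1`, so `ι_v(p) e ∈ E_v^{−×}`).
[cite: Liu2021, App. D §D.1 Step 1 (l. 5217)] -/
theorem map_mul_mem_skew (e : LemD1.EpsRep (LemD1OfPlace.standingData E v c N J hcδ hδ hN hJh hJdet))
    (p : (v.adicCompletion F)ˣ) :
    ((Units.map (algebraMap (v.adicCompletion F) (LocalRing E v)).toMonoidHom p * e.1 : (LocalRing E v)ˣ) : LocalRing E v) ∈
      (LemD1OfPlace.standingData E v c N J hcδ hδ hN hJh hJdet).skew := by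
  rw [OscillatorStandingData.mem_skew_iff, LemD1OfPlace.standingData_conj_apply, Units.val_mul, Units.coe_map,
    RingHom.toMonoidHom_eq_coe, MonoidHom.coe_coe, map_mul, algebraMap_localRing_eq, conjLocal_toLocalRing,
    conjLocal_epsRep E v c hcδ hδ N J hN hJh hJdet e, mul_neg, add_neg_cancel]

/-- **every Step-1 representative of the place model is an `F_vˣ`-multiple of any other**: for `e, e' ∈ E_v^{−×}` there is
`p ∈ F_vˣ` with `e' = ι_v(p) · e` — the unit `e' e⁻¹` is fixed by `c ⊗ 1`, hence lies in `ι_v(F_v)`.  So the printed index set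
`E^{−×}/Nm_{E/F} E^×` of Step 1, read at the place model, is `F_vˣ / Nm E_vˣ`. [cite: Liu2021, App. D §D.1 Step 1 (l. 5217)] -/
theorem exists_epsRep_eq_map_mul (e e' : LemD1.EpsRep (LemD1OfPlace.standingData E v c N J hcδ hδ hN hJh hJdet)) :
    ∃ p : (v.adicCompletion F)ˣ, e'.1 = Units.map (algebraMap (v.adicCompletion F) (LocalRing E v)).toMonoidHom p * e.1 := by
  set κ : (LocalRing E v)ˣ →* (LocalRing E v)ˣ := Units.map (conjLocal E c v).toMonoidHom with hκ
  have hκe : ∀ f : LemD1.EpsRep (LemD1OfPlace.standingData E v c N J hcδ hδ hN hJh hJdet), κ f.1 = -f.1 := fun f =>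
    Units.ext (by rw [hκ, Units.coe_map, Units.val_neg]; exact conjLocal_epsRep E v c hcδ hδ N J hN hJh hJdet f)
  set r : (LocalRing E v)ˣ := e'.1 * e.1⁻¹ with hr
  have hκr : κ r = r := by rw [hr, map_mul, map_inv, hκe, hκe, inv_neg, neg_mul_neg]
  have hfix : conjLocal E c v (r : LocalRing E v) = r := by
    have h := congrArg (fun u : (LocalRing E v)ˣ => (u : LocalRing E v)) hκr
    simpa only [hκ, Units.coe_map, RingHom.toMonoidHom_eq_coe, MonoidHom.coe_coe] using h
  obtain ⟨p, hp⟩ := exists_eq_toLocalRing_of_conjLocal_eq E v c hcδ hδ (r : LocalRing E v) hfix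
  have hp0 : p ≠ 0 := fun h => r.ne_zero (by rw [hp, h, map_zero])
  refine ⟨Units.mk0 p hp0, Units.ext ?_⟩
  rw [Units.val_mul, Units.coe_map, RingHom.toMonoidHom_eq_coe, MonoidHom.coe_coe, Units.val_mk0, algebraMap_localRing_eq,
    ← hp, hr, Units.val_mul, Units.inv_mul_cancel_right]

/-- **the class of `ι_v(p) · e` is that of `e` iff `p` is a norm from `E_vˣ`** (`SameClass e (ι_v(p) e) ↔ ∃ x, x · (c ⊗ 1) x = ι_v p`:
cancel the unit `e`). [cite: Liu2021, App. D §D.1 Step 1 (l. 5217)] -/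
theorem sameClass_map_mul_iff (e : LemD1.EpsRep (LemD1OfPlace.standingData E v c N J hcδ hδ hN hJh hJdet))
    (p : (v.adicCompletion F)ˣ) :
    LemD1.SameClass e ⟨Units.map (algebraMap (v.adicCompletion F) (LocalRing E v)).toMonoidHom p * e.1,
        map_mul_mem_skew E v c hcδ hδ N J hN hJh hJdet e p⟩ ↔
      ∃ x : (LocalRing E v)ˣ, (x : LocalRing E v) * conjLocal E c v x =
        algebraMap (v.adicCompletion F) (LocalRing E v) p := by
  constructor
  · rintro ⟨x, hx⟩
    refine ⟨x, ?_⟩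
    have h : Units.map (algebraMap (v.adicCompletion F) (LocalRing E v)).toMonoidHom p =
        x * Units.map ((LemD1OfPlace.standingData E v c N J hcδ hδ hN hJh hJdet).σ : LocalRing E v →* LocalRing E v) x :=
      mul_right_cancel hx
    have h' := congrArg (fun u : (LocalRing E v)ˣ => (u : LocalRing E v)) h
    simp only [Units.val_mul, Units.coe_map, RingHom.toMonoidHom_eq_coe, MonoidHom.coe_coe] at h'
    rw [h']
    rfl
  · rintro ⟨x, hx⟩
    refine ⟨x, ?_⟩
    change Units.map (algebraMap (v.adicCompletion F) (LocalRing E v)).toMonoidHom p * e.1 = _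
    congr 1
    apply Units.ext
    simp only [Units.val_mul, Units.coe_map, RingHom.toMonoidHom_eq_coe, MonoidHom.coe_coe]
    rw [← hx]
    rfl

/-- **at a SPLIT place there is ONE `ε`-class**: all Step-1 representatives of the place model are equivalent (every
`p ∈ F_vˣ` is a norm there, `LemD1IndexedNonVacuityAtPlace.exists_mul_conjLocal_eq_algebraMap_of_split`), so the `ε`-slot
of [Lem. D.1 (3)∕(4)] never separates labels at a split place. [cite: Liu2021, App. D §D.1 Step 1 (l. 5217); Lemma D.1 (3) (l. 5233)] -/
theorem sameClass_of_split (w : PlacesOver E v) (hw : c • w.1 ≠ w.1)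
    (e e' : LemD1.EpsRep (LemD1OfPlace.standingData E v c N J hcδ hδ hN hJh hJdet)) : LemD1.SameClass e e' := by
  obtain ⟨p, hp⟩ := exists_epsRep_eq_map_mul E v c hcδ hδ N J hN hJh hJdet e e'
  obtain ⟨e'₁, he'⟩ := e'
  change e'₁ = _ at hp
  subst hp
  exact (sameClass_map_mul_iff E v c hcδ hδ N J hN hJh hJdet e p).2
    (LemD1IndexedNonVacuityAtPlace.exists_mul_conjLocal_eq_algebraMap_of_split E v c w hw p)

include hcδ hδ in
/-- **at a NON-SPLIT place there are at least TWO `ε`-classes**: for every representative `e`, the twist `ι_v(a) · e` by a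
non-norm `a ∈ F_vˣ` (§2) is a representative NOT in the class of `e`. [cite: Liu2021, App. D §D.1 Step 1 (l. 5217); Lemma D.1 (3) (l. 5233)]
[cite: Omeara1963, §63B Cor. 63:13a] -/
theorem exists_epsRep_not_sameClass_of_nonsplit (w : PlacesOver E v) (hw : c • w.1 = w.1)
    (e : LemD1.EpsRep (LemD1OfPlace.standingData E v c N J hcδ hδ hN hJh hJdet)) :
    ∃ e' : LemD1.EpsRep (LemD1OfPlace.standingData E v c N J hcδ hδ hN hJh hJdet), ¬ LemD1.SameClass e e' := by
  obtain ⟨a, ha⟩ := exists_not_isNorm_of_nonsplit E v c hcδ hδ w hw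
  exact ⟨_, fun h => ha ((sameClass_map_mul_iff E v c hcδ hδ N J hN hJh hJdet e a).1 h)⟩

include hcδ hδ in
/-- **at a NON-SPLIT place there are EXACTLY TWO `ε`-classes**: given `e₀`, there is `e₁` (the twist of `e₀` by a non-norm) with
`e₁ ≁ e₀` such that EVERY representative is equivalent to `e₀` or to `e₁` — every `e` is `ι_v(p) · e₀`, and `F_vˣ / Nm E_vˣ` has
order `2` (`index_norms_eq_two_of_nonsplit`; Mathlib `Subgroup.mul_mem_iff_of_index_two`).  This is the printed Step-1 index set
`E^{−×}/Nm_{E/F}E^×` — two elements over a field — realised at the rows' slot types. [cite: Liu2021, App. D §D.1 Step 1 (l. 5217); Lemma D.1 (3)–(4) (l. 5233–5235)]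
[cite: Omeara1963, §63B Cor. 63:13a] -/
theorem epsRep_two_classes_of_nonsplit (w : PlacesOver E v) (hw : c • w.1 = w.1)
    (e₀ : LemD1.EpsRep (LemD1OfPlace.standingData E v c N J hcδ hδ hN hJh hJdet)) :
    ∃ e₁ : LemD1.EpsRep (LemD1OfPlace.standingData E v c N J hcδ hδ hN hJh hJdet), ¬ LemD1.SameClass e₀ e₁ ∧
      ∀ e : LemD1.EpsRep (LemD1OfPlace.standingData E v c N J hcδ hδ hN hJh hJdet),
        LemD1.SameClass e₀ e ∨ LemD1.SameClass e₁ e := by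
  obtain ⟨d, hd⟩ := exists_delta_mul_self_eq_algebraMap E c hcδ hδ
  have hidx := index_norms_eq_two_of_nonsplit E v c hcδ hδ w hw hd
  obtain ⟨a, ha⟩ := exists_not_isNorm_of_nonsplit E v c hcδ hδ w hw
  have haN : a ∉ quadraticNormSubgroup (v.adicCompletion F) (d : v.adicCompletion F) :=
    fun h => ha ((isNorm_iff_mem_quadraticNormSubgroup E v c hcδ hδ hd a).2 h)
  refine ⟨⟨_, map_mul_mem_skew E v c hcδ hδ N J hN hJh hJdet e₀ a⟩,
    fun h => ha ((sameClass_map_mul_iff E v c hcδ hδ N J hN hJh hJdet e₀ a).1 h), fun e => ?_⟩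
  obtain ⟨p, hp⟩ := exists_epsRep_eq_map_mul E v c hcδ hδ N J hN hJh hJdet e₀ e
  obtain ⟨e₁', he'⟩ := e
  change e₁' = _ at hp
  subst hp
  by_cases hpN : p ∈ quadraticNormSubgroup (v.adicCompletion F) (d : v.adicCompletion F)
  · exact Or.inl ((sameClass_map_mul_iff E v c hcδ hδ N J hN hJh hJdet e₀ p).2
      ((isNorm_iff_mem_quadraticNormSubgroup E v c hcδ hδ hd p).2 hpN))
  · right
    -- `p a⁻¹` is a norm (index two), and `ι(p) e₀ = ι(p a⁻¹) · (ι(a) e₀)`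
    have hpa : p * a⁻¹ ∈ quadraticNormSubgroup (v.adicCompletion F) (d : v.adicCompletion F) := by
      rw [Subgroup.mul_mem_iff_of_index_two hidx, Subgroup.inv_mem_iff]
      exact ⟨fun h => absurd h hpN, fun h => absurd h haN⟩
    obtain ⟨y, hy⟩ := (isNorm_iff_mem_quadraticNormSubgroup E v c hcδ hδ hd (p * a⁻¹)).2 hpa
    have key := (sameClass_map_mul_iff E v c hcδ hδ N J hN hJh hJdet
      ⟨_, map_mul_mem_skew E v c hcδ hδ N J hN hJh hJdet e₀ a⟩ (p * a⁻¹)).2 ⟨y, hy⟩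
    have heq : Units.map (algebraMap (v.adicCompletion F) (LocalRing E v)).toMonoidHom (p * a⁻¹) *
        (Units.map (algebraMap (v.adicCompletion F) (LocalRing E v)).toMonoidHom a * e₀.1) =
        Units.map (algebraMap (v.adicCompletion F) (LocalRing E v)).toMonoidHom p * e₀.1 := by
      rw [map_mul, map_inv, ← mul_assoc, inv_mul_cancel_right]
    simpa only [heq] using key

/-! ## §2c The teeth of [Lem. D.1 (3)] in the `ε`-slot at a non-split place (rank `N ≥ 3`) -/

/-- **Item (1) AS PRINTED holds at a character datum of rank `n ≠ 2`** (both sides of (1) false, the right one through its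
conjunct «(in particular `n = 2`)»; the maximal `χ`-quotient is the line: irreducible, admissible, non-zero).  Private twin of
`LemD1IndexedNonVacuityNonsplit.lemD1_1AsPrinted_of_character_of_rank_ne_two` (kept private, as in
`LemD1IndexedNonVacuityAtPlace`, to keep this file's import closure free of the `ℚ₃(i)` leaf). [cite: Liu2021, App. D Lemma D.1 (1) (l. 5229)] -/
private theorem lemD1_1AsPrinted_of_character_of_rank_ne_two' {F₀ E₀ : Type} [Field F₀] [ValuativeRel F₀]
    [TopologicalSpace F₀] [CommRing E₀] [Algebra F₀ E₀] [TopologicalSpace E₀] [IsTopologicalRing E₀] {n₀ : ℕ}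
    (L : LemD1Data F₀ E₀ n₀ ℂ) (lam : L.S.U →* ℂˣ) (hω : ∀ (g : L.S.U) (x : ℂ), L.omega g x = (lam g : ℂ) * x)
    (hcen : ∀ z : L.S.normOne, lam (L.S.scalar z) = L.chi z)
    (hopen : ∃ O : Set L.S.U, IsOpen O ∧ (1 : L.S.U) ∈ O ∧ ∀ g ∈ O, lam g = 1) (hn : n₀ ≠ 2) :
    LemD1_1AsPrinted L := by
  have hN : augmentation L.omega L.S.scalar L.chi = ⊥ := by
    unfold augmentation
    refine iSup_eq_bot.2 fun z => ?_
    rw [LinearMap.range_eq_bot]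
    ext
    simp [hω, hcen]
  have hfin : Module.finrank ℂ (ℂ ⧸ augmentation L.omega L.S.scalar L.chi) = 1 := by
    rw [(Submodule.quotEquivOfEqBot _ hN).finrank_eq, Module.finrank_self]
  haveI hsimple : IsSimpleModule ℂ (ℂ ⧸ augmentation L.omega L.S.scalar L.chi) :=
    isSimpleModule_iff_finrank_eq_one.2 hfin
  have hact : ∀ (g : L.S.U) (w : ℂ ⧸ augmentation L.omega L.S.scalar L.chi),
      L.datum.quot g w = (lam g : ℂ) • w := by
    intro g w
    obtain ⟨y, rfl⟩ := Submodule.Quotient.mk_surjective _ w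
    rw [LemD1Data.datum_quot, quotRep_mk, hω, ← smul_eq_mul, Submodule.Quotient.mk_smul]
  refine ⟨⟨?_, ?_, ?_⟩, ?_⟩
  · intro W
    rcases eq_bot_or_eq_top W.toSubmodule with h | h
    · exact Or.inl (Subrepresentation.toSubmodule_injective h)
    · exact Or.inr (Subrepresentation.toSubmodule_injective h)
  · intro x
    obtain ⟨O, hO, h1O, hlam⟩ := hopen
    change IsOpen (L.datum.quot.stabilizerSubgroup x : Set L.S.U)
    refine Subgroup.isOpen_of_mem_nhds _ (g := 1) (Filter.mem_of_superset (hO.mem_nhds h1O) fun g hg => ?_)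
    change L.datum.quot g x = x
    rw [hact, hlam g hg, Units.val_one, one_smul]
  · intro K _
    infer_instance
  · refine iff_of_false ?_ ?_
    · rw [not_subsingleton_iff_nontrivial]
      exact Module.nontrivial_of_finrank_pos (R := ℂ) (by rw [hfin]; exact one_pos)
    · exact fun h => hn h.2.1.2

include hcδ hδ in
/-- **[Lem. D.1 (3)] AS PRINTED has teeth in the `ε`-slot at a NON-SPLIT place** (rank `N ≥ 3`): for ANY Step-2 character
`μ` of the place model and any representative `e₀`, the two-member collection with labels `(μ, e₀, 1)`, `(μ, ι_v(a) · e₀, 1)` —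
`a ∈ F_vˣ` a non-norm (§2), so the two `ε`-labels are in DIFFERENT classes (§2b) — and BOTH carriers the trivial line satisfies
(1) member by member (rank `≠ 2`) but VIOLATES `LemD1_3AsPrintedI`: its two `ω`'s are isomorphic (equal) while `ε₀ ≁ ε₁`.  At a
split place the same construction never separates (`sameClass_of_split`): the `ε`-conjunct of (3) bites exactly at the non-split
places. [cite: Liu2021, App. D Lemma D.1 (1) and (3) (l. 5229, 5233)] -/
theorem exists_lemD1IndexedFamily_item1_not_lemD1_3_eps_of_nonsplit (w : PlacesOver E v) (hw : c • w.1 = w.1) (h3 : 3 ≤ N)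
    (μ : LemD1.MuSet (LemD1OfPlace.standingData E v c N J hcδ hδ hN hJh hJdet))
    (e₀ : LemD1.EpsRep (LemD1OfPlace.standingData E v c N J hcδ hδ hN hJh hJdet)) :
    ∃ Lf : LemD1IndexedFamily (v.adicCompletion F) (LocalRing E v) N (Fin 2),
      Lf.S = LemD1OfPlace.standingData E v c N J hcδ hδ hN hJh hJdet ∧
      (∀ i, (Lf.mu i).1 = μ.1) ∧ (∀ i, (Lf.chi i).1 = 1) ∧ (Lf.eps 0).1 = e₀.1 ∧
      ¬ LemD1.SameClass (Lf.eps 0) (Lf.eps 1) ∧ Lf.Item1AsPrinted ∧ ¬ LemD1_3AsPrintedI Lf := by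
  classical
  have hN2 : N ≠ 2 := by omega
  obtain ⟨a, ha⟩ := exists_not_isNorm_of_nonsplit E v c hcδ hδ w hw
  -- (no `set S := …`: it would re-assert `μ`, `e₀` and detach them from the goal)
  let e₁ : LemD1.EpsRep (LemD1OfPlace.standingData E v c N J hcδ hδ hN hJh hJdet) :=
    ⟨_, map_mul_mem_skew E v c hcδ hδ N J hN hJh hJdet e₀ a⟩
  have hne : ¬ LemD1.SameClass e₀ e₁ := fun h => ha ((sameClass_map_mul_iff E v c hcδ hδ N J hN hJh hJdet e₀ a).1 h)
  let χ : LemD1.ChiSet (LemD1OfPlace.standingData E v c N J hcδ hδ hN hJh hJdet) :=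
    ⟨1, fun z => by simp, by simpa using continuous_const⟩
  let ω₀ : Representation ℂ (LemD1OfPlace.standingData E v c N J hcδ hδ hN hJh hJdet).U ℂ :=
    Representation.trivial ℂ _ ℂ
  have hω₀ : ∀ (g : (LemD1OfPlace.standingData E v c N J hcδ hδ hN hJh hJdet).U) (x : ℂ),
      ω₀ g x = ((1 : (LemD1OfPlace.standingData E v c N J hcδ hδ hN hJh hJdet).U →* ℂˣ) g : ℂ) * x := fun g x => by
    rw [MonoidHom.one_apply, Units.val_one, one_mul]; rfl
  let Lf : LemD1IndexedFamily (v.adicCompletion F) (LocalRing E v) N (Fin 2) :=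
    { isNonarchimedeanLocalField := inferInstance
      isModuleTopology := LemD1OfPlace.isModuleTopology_localRing E v
      S := LemD1OfPlace.standingData E v c N J hcδ hδ hN hJh hJdet
      mu := fun _ => μ
      eps := ![e₀, e₁]
      chi := fun _ => χ
      V := fun _ => ℂ
      omega := fun _ => ω₀ }
  have hItem1 : Lf.Item1AsPrinted := fun i =>
    lemD1_1AsPrinted_of_character_of_rank_ne_two' (Lf.single i) 1 hω₀ (fun z => rfl)
      ⟨Set.univ, isOpen_univ, Set.mem_univ _, fun g _ => rfl⟩ hN2
  have hne' : ¬ LemD1.SameClass (Lf.eps 0) (Lf.eps 1) := hne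
  have hnot3 : ¬ LemD1_3AsPrintedI Lf := fun h => hne' ((h h3 0 1).1 (AreIsomorphicRep.refl _)).2.1
  exact ⟨Lf, rfl, fun _ => rfl, fun _ => rfl, rfl, hne', hItem1, hnot3⟩

end General

/-! ## §3 The CM rows: at EVERY finite place of `L⁺` the rows' own Step-2 slot `localMu L (toHeckeCharacter L ψ) v`
inhabits `MuSet`, and the `hD1''` type former holds on the trivial line with the rows' own `F⁺_v ∕ L_v ∕ S ∕ ε ∕ μ` slots -/

section CM

open Literature.NumberTheory.GelbartRogawski1991.UnitaryDualPair (imagUnit complexConj_imagUnit imagUnit_ne_zero)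
open Literature.NumberTheory.GelbartRogawski1991.UnitaryDualPair.LocalSplitting (localMu norm_localMu continuous_localMu
  localMu_toLocalRing_eq_one_iff)
open Literature.NumberTheory.Automorphic.IdeleClassGroup (toHeckeCharacter isUnitary_toHeckeCharacter IsConjugateSymplectic
  HasWeight exists_isConjugateSymplectic_hasCMType)
open Literature.RepresentationTheory.Liu2021 (isOscillatorChar_toHeckeCharacter_iff)
open Literature.NumberTheory.ComplexMultiplication (CMTypeCount.nonempty_cmType_iff_isTotallyComplex)

variable (L : Type) [Field L] [NumberField L] [IsCMField L]

local notation3 "cc" => (IsCMField.complexConj L)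
local notation3 "L⁺" => (↥(maximalRealSubfield L))

/-- **The rows' Step-2 binder types are inhabited, for every CM field**: there is a continuous unitary character
`ψ : C_L → S¹` which is conjugate symplectic ([Liu2021, Def. 4.1]: `ψ|_{𝔸_{L⁺}^×} = μ_{L/L⁺}`) and of weight one
([Liu2021, Def. 4.3]) — the tree's kernel theorem `IdeleClassGroup.exists_isConjugateSymplectic_hasCMType` at any CM type
of `L` (CM types exist on a CM field, `CMTypeCount.nonempty_cmType_iff_isTotallyComplex`).  Bookkeeping corollary; these are
the types of the ∀-bound `(μ, hμ, hw)` of the displayed rows `hD1''` ∕ `hD3` ∕ `h411` ∕ `hLiu418`.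
[cite: Liu2021, Def. 4.1 (l. 1900–1902) and Def. 4.3] -/
theorem exists_isConjugateSymplectic_hasWeight_one :
    ∃ ψ : IdeleClassGroup L →ₜ* Circle, IsConjugateSymplectic L ψ ∧ HasWeight L ψ 1 := by
  obtain ⟨Φ⟩ := (CMTypeCount.nonempty_cmType_iff_isTotallyComplex (K := L)).2 inferInstance
  obtain ⟨ψ, hψ, hw, -⟩ := exists_isConjugateSymplectic_hasCMType Φ
  exact ⟨ψ, hψ, hw⟩

-- (the `L⁺` notation is not used inside `variable` binders: a `notation3` token there hides the variable from proof bodies)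
variable (v : HeightOneSpectrum (𝓞 (maximalRealSubfield L))) (N : ℕ) (J : Matrix (Fin N) (Fin N) L) (hN : 2 ≤ N)
  (hJh : (J.map (IsCMField.complexConj L))ᵀ = J) (hJdet : J.det ≠ 0)

/-- **At EVERY finite place `v` of `L⁺` (split, inert or ramified) the printed Step-2 index set of the rows' standing data
`LemD1OfPlace.standingData L v c N J …` is NON-EMPTY**, inhabited by VERBATIM the rows' own μ-slot former: for a conjugate
symplectic `ψ` (which exists, `exists_isConjugateSymplectic_hasWeight_one`) the local component
`μ_v := localMu L (toHeckeCharacter L ψ) v` with its three displayed proofs `norm_localMu` ∕ `continuous_localMu` ∕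
`localMu_toLocalRing_eq_one_iff … ((isOscillatorChar_toHeckeCharacter_iff ψ).mpr hψ)`, packaged by `LemD1OfPlace.muOf`.
(At a split place `1 ∈ MuSet` already, `LemD1IndexedNonVacuityAtPlace.one_mem_muSet_of_split`; at a non-split place `1 ∉ MuSet`
(§2) and this global supply is what inhabits Step 2 for the place model.) [cite: Liu2021, App. D §D.1 Step 2 (l. 5219); Def. 4.11 (l. 2086)] -/
theorem exists_muSet_val_eq_localMu :
    ∃ ψ : IdeleClassGroup L →ₜ* Circle, IsConjugateSymplectic L ψ ∧ HasWeight L ψ 1 ∧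
      ∃ μ : LemD1.MuSet (LemD1OfPlace.standingData L v cc N J (complexConj_imagUnit L) (imagUnit_ne_zero L) hN hJh hJdet),
        μ.1 = localMu L (toHeckeCharacter L ψ) v := by
  obtain ⟨ψ, hψ, hw⟩ := exists_isConjugateSymplectic_hasWeight_one L
  exact ⟨ψ, hψ, hw,
    LemD1OfPlace.muOf L v cc N J (complexConj_imagUnit L) (imagUnit_ne_zero L) hN hJh hJdet
      (localMu L (toHeckeCharacter L ψ) v)
      (fun x => norm_localMu L (toHeckeCharacter L ψ) v (isUnitary_toHeckeCharacter L ψ) x)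
      (continuous_localMu L (toHeckeCharacter L ψ) v)
      (fun t => localMu_toLocalRing_eq_one_iff L (toHeckeCharacter L ψ) v
        ((isOscillatorChar_toHeckeCharacter_iff ψ).mpr hψ) t), rfl⟩

/-- **`MuSet` of the rows' standing data is non-empty at every finite place of `L⁺`.** [cite: Liu2021, App. D §D.1 Step 2 (l. 5219)] -/
theorem nonempty_muSet_of_isCMField :
    Nonempty (LemD1.MuSet (LemD1OfPlace.standingData L v cc N J (complexConj_imagUnit L) (imagUnit_ne_zero L) hN hJh hJdet)) := by
  obtain ⟨-, -, -, μ, -⟩ := exists_muSet_val_eq_localMu L v N J hN hJh hJdet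
  exact ⟨μ⟩

variable (J₁ : Matrix (Fin 1) (Fin 1) L)

/-- **The `hD1''` type former with the rows' OWN `F⁺_v ∕ L_v ∕ S ∕ ε ∕ μ` slots holds on the trivial line at EVERY finite
place, rank `N ≠ 2`**: for every conjugate symplectic `ψ`, every finite place `v` of `L⁺`, every hermitian non-degenerate `J`,
every `J₁`, the record [Liu2021, Lem. D.1, first sentence + (1)] AS PRINTED holds at
`LemD1OfPlace.data L v c N J … J₁ (trivial line) (localMu L (toHeckeCharacter L ψ) v) (norm_localMu …) (continuous_localMu …)
(localMu_toLocalRing_eq_one_iff …) 1 h1n h1c` — the μ-slot and its three proofs being the displayed row's own terms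
(`LemD1IndexedNonVacuityAtPlace.lemD1_1AsPrinted_data_trivial_of_rank_ne_two` at this datum: the `χ`-quotient is the non-zero
line, the right-hand side of (1) fails through «`n = 2`»). [cite: Liu2021, App. D Lemma D.1 (1) (l. 5229)] -/
theorem lemD1_1AsPrinted_data_trivial_localMu (ψ : IdeleClassGroup L →ₜ* Circle) (hψ : IsConjugateSymplectic L ψ)
    (hN2 : N ≠ 2)
    (h1n : ∀ h : localPi L cc 1 J₁ v, ‖(((1 : localPi L cc 1 J₁ v →* ℂˣ) h : ℂˣ) : ℂ)‖ = 1)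
    (h1c : Continuous fun h : localPi L cc 1 J₁ v => (((1 : localPi L cc 1 J₁ v →* ℂˣ) h : ℂˣ) : ℂ)) :
    LemD1_1AsPrinted (LemD1OfPlace.data L v cc N J (complexConj_imagUnit L) (imagUnit_ne_zero L) hN hJh hJdet J₁
      (Representation.trivial ℂ (localPi L cc N J v) ℂ) (localMu L (toHeckeCharacter L ψ) v)
      (fun x => norm_localMu L (toHeckeCharacter L ψ) v (isUnitary_toHeckeCharacter L ψ) x)
      (continuous_localMu L (toHeckeCharacter L ψ) v)
      (fun t => localMu_toLocalRing_eq_one_iff L (toHeckeCharacter L ψ) v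
        ((isOscillatorChar_toHeckeCharacter_iff ψ).mpr hψ) t)
      1 h1n h1c) :=
  LemD1IndexedNonVacuityAtPlace.lemD1_1AsPrinted_data_trivial_of_rank_ne_two L v cc N J (complexConj_imagUnit L)
    (imagUnit_ne_zero L) hN hJh hJdet J₁ hN2 _ _ _ _ h1n h1c

/-- **Headline of §3**: there IS a conjugate symplectic weight-one `ψ` (the rows' `(μ, hμ, hw)` binder types inhabited) such
that at EVERY finite place `v` of `L⁺`, for every hermitian non-degenerate `J` of rank `N ≥ 3` (`N ≠ 2`) and every `J₁`, the
`hD1''` type former on the trivial line with the rows' own μ-slot `localMu L (toHeckeCharacter L ψ) v` holds.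
[cite: Liu2021, App. D Lemma D.1 (1) (l. 5229); Def. 4.1; Def. 4.3] -/
theorem exists_isConjugateSymplectic_forall_lemD1_1AsPrinted_data_trivial :
    ∃ (ψ : IdeleClassGroup L →ₜ* Circle) (hψ : IsConjugateSymplectic L ψ), HasWeight L ψ 1 ∧
      ∀ (v : HeightOneSpectrum (𝓞 L⁺)) (N : ℕ) (J : Matrix (Fin N) (Fin N) L) (hN : 2 ≤ N)
        (hJh : (J.map (IsCMField.complexConj L))ᵀ = J) (hJdet : J.det ≠ 0) (_hN2 : N ≠ 2) (J₁ : Matrix (Fin 1) (Fin 1) L)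
        (h1n : ∀ h : localPi L cc 1 J₁ v, ‖(((1 : localPi L cc 1 J₁ v →* ℂˣ) h : ℂˣ) : ℂ)‖ = 1)
        (h1c : Continuous fun h : localPi L cc 1 J₁ v => (((1 : localPi L cc 1 J₁ v →* ℂˣ) h : ℂˣ) : ℂ)),
        LemD1_1AsPrinted (LemD1OfPlace.data L v cc N J (complexConj_imagUnit L) (imagUnit_ne_zero L) hN hJh hJdet J₁
          (Representation.trivial ℂ (localPi L cc N J v) ℂ) (localMu L (toHeckeCharacter L ψ) v)
          (fun x => norm_localMu L (toHeckeCharacter L ψ) v (isUnitary_toHeckeCharacter L ψ) x)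
          (continuous_localMu L (toHeckeCharacter L ψ) v)
          (fun t => localMu_toLocalRing_eq_one_iff L (toHeckeCharacter L ψ) v
            ((isOscillatorChar_toHeckeCharacter_iff ψ).mpr hψ) t)
          1 h1n h1c) := by
  obtain ⟨ψ, hψ, hw⟩ := exists_isConjugateSymplectic_hasWeight_one L
  exact ⟨ψ, hψ, hw, fun v N J hN hJh hJdet hN2 J₁ h1n h1c =>
    lemD1_1AsPrinted_data_trivial_localMu L v N J hN hJh hJdet J₁ ψ hψ hN2 h1n h1c⟩

/-! ## §4 The rows' own `μ_v` place by place: `≡ 1` on `ι_v(L⁺_vˣ)` at a split place, `= -1` somewhere at a non-split place -/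

/-- **at a SPLIT place the rows' own `μ_v = localMu L (toHeckeCharacter L ψ) v` is TRIVIAL on `ι_v(L⁺_vˣ)`** (`ψ` conjugate
symplectic): the printed clause holds for `μ_v` (`localMu_toLocalRing_eq_one_iff`) and every `a ∈ L⁺_vˣ` is a norm at a split
place (`LemD1IndexedNonVacuityAtPlace.exists_mul_conjLocal_eq_algebraMap_of_split`). [cite: Liu2021, App. D §D.1 Step 2 (l. 5219)] -/
theorem localMu_toHeckeCharacter_apply_eq_one_of_split (ψ : IdeleClassGroup L →ₜ* Circle)
    (hψ : IsConjugateSymplectic L ψ) (w : PlacesOver L v) (hw : cc • w.1 ≠ w.1) (a : (v.adicCompletion L⁺)ˣ) :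
    localMu L (toHeckeCharacter L ψ) v (Units.map (algebraMap (v.adicCompletion L⁺) (LocalRing L v)).toMonoidHom a) = 1 :=
  (localMu_toLocalRing_eq_one_iff L (toHeckeCharacter L ψ) v ((isOscillatorChar_toHeckeCharacter_iff ψ).mpr hψ) a).2
    (LemD1IndexedNonVacuityAtPlace.exists_mul_conjLocal_eq_algebraMap_of_split L v cc w hw a)

/-- **at a NON-SPLIT place the rows' own `μ_v` takes the value `-1` on `ι_v(L⁺_vˣ)`** (`ψ` conjugate symplectic; §2 at the
datum `(μ_v, hμF)` of the row). [cite: Liu2021, App. D §D.1 Step 2 (l. 5219)] [cite: Omeara1963, §63B Cor. 63:13a] -/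
theorem exists_localMu_toHeckeCharacter_apply_eq_neg_one_of_nonsplit (ψ : IdeleClassGroup L →ₜ* Circle)
    (hψ : IsConjugateSymplectic L ψ) (w : PlacesOver L v) (hw : cc • w.1 = w.1) :
    ∃ a : (v.adicCompletion L⁺)ˣ,
      localMu L (toHeckeCharacter L ψ) v (Units.map (algebraMap (v.adicCompletion L⁺) (LocalRing L v)).toMonoidHom a) = -1 :=
  exists_apply_eq_neg_one_of_nonsplit L v cc (complexConj_imagUnit L) (imagUnit_ne_zero L) w hw _
    (fun t => localMu_toLocalRing_eq_one_iff L (toHeckeCharacter L ψ) v ((isOscillatorChar_toHeckeCharacter_iff ψ).mpr hψ) t)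

/-- **… so at a non-split place the rows' own `μ_v` is not the trivial character.** [cite: Liu2021, App. D §D.1 Step 2 (l. 5219)] -/
theorem localMu_toHeckeCharacter_ne_one_of_nonsplit (ψ : IdeleClassGroup L →ₜ* Circle)
    (hψ : IsConjugateSymplectic L ψ) (w : PlacesOver L v) (hw : cc • w.1 = w.1) :
    localMu L (toHeckeCharacter L ψ) v ≠ 1 :=
  ne_one_of_stepTwo_of_nonsplit L v cc (complexConj_imagUnit L) (imagUnit_ne_zero L) w hw _
    (fun t => localMu_toLocalRing_eq_one_iff L (toHeckeCharacter L ψ) v ((isOscillatorChar_toHeckeCharacter_iff ψ).mpr hψ) t)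

/-! ## §5 (1) ∧ (3) at the rows' slot types with the rows' own `μ`-slot, at EVERY place; and the `ε`-teeth of (3) at a
non-split place with the rows' own `μ` -/

/-- **«(1) for every member ∧ (3)» is JOINTLY SATISFIABLE at EVERY finite place `v` of `L⁺` (split, inert or ramified) on a
collection whose `F ∕ E ∕ S ∕ ε ∕ μ` slots are ALL the rows' own** — `F_v = v.adicCompletion L⁺`, `E_v = UnitaryGroup.LocalRing L v`,
`S = LemD1OfPlace.standingData L v c N J …` (`rfl`), any representative `e`, and `μ_i = localMu L (toHeckeCharacter L ψ) v` packaged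
by `LemD1OfPlace.muOf` with its three displayed proofs (`ψ` conjugate symplectic) —, `χ_i = 1`, every carrier the trivial line, rank
`N ≥ 3`, ANY index type `ι`: (1) holds member by member (rank `≠ 2`), and (3) holds because all members carry the same label and the
same `ω`.  HONEST SCOPE: (3) is exercised here only at EQUAL labels; a collection with two DIFFERENT labels satisfying (1) ∧ (3) at a
non-split place needs a second irreducible admissible representation of `U(J)(F_v)` with open stabilisers and trivial central action
(e.g. a character through `det` and a ramified character of `E_w¹`), which this file does not construct. [cite: Liu2021, App. D Lemma D.1 (1) and (3) (l. 5229, 5233)] -/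
theorem exists_lemD1IndexedFamily_localMu (ψ : IdeleClassGroup L →ₜ* Circle) (hψ : IsConjugateSymplectic L ψ) (h3 : 3 ≤ N)
    (e : LemD1.EpsRep (LemD1OfPlace.standingData L v cc N J (complexConj_imagUnit L) (imagUnit_ne_zero L) hN hJh hJdet))
    (ι : Type) :
    ∃ Lf : LemD1IndexedFamily (v.adicCompletion L⁺) (LocalRing L v) N ι,
      Lf.S = LemD1OfPlace.standingData L v cc N J (complexConj_imagUnit L) (imagUnit_ne_zero L) hN hJh hJdet ∧
      (∀ i, (Lf.mu i).1 = localMu L (toHeckeCharacter L ψ) v) ∧ (∀ i, (Lf.eps i).1 = e.1) ∧ (∀ i, (Lf.chi i).1 = 1) ∧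
      Lf.Item1AsPrinted ∧ LemD1_3AsPrintedI Lf := by
  have hN2 : N ≠ 2 := by omega
  let μ : LemD1.MuSet (LemD1OfPlace.standingData L v cc N J (complexConj_imagUnit L) (imagUnit_ne_zero L) hN hJh hJdet) :=
    LemD1OfPlace.muOf L v cc N J (complexConj_imagUnit L) (imagUnit_ne_zero L) hN hJh hJdet
      (localMu L (toHeckeCharacter L ψ) v)
      (fun x => norm_localMu L (toHeckeCharacter L ψ) v (isUnitary_toHeckeCharacter L ψ) x)
      (continuous_localMu L (toHeckeCharacter L ψ) v)
      (fun t => localMu_toLocalRing_eq_one_iff L (toHeckeCharacter L ψ) v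
        ((isOscillatorChar_toHeckeCharacter_iff ψ).mpr hψ) t)
  let χ : LemD1.ChiSet (LemD1OfPlace.standingData L v cc N J (complexConj_imagUnit L) (imagUnit_ne_zero L) hN hJh hJdet) :=
    ⟨1, fun z => by simp, by simpa using continuous_const⟩
  let ω₀ : Representation ℂ (LemD1OfPlace.standingData L v cc N J (complexConj_imagUnit L) (imagUnit_ne_zero L) hN hJh hJdet).U ℂ :=
    Representation.trivial ℂ _ ℂ
  have hω₀ : ∀ (g : (LemD1OfPlace.standingData L v cc N J (complexConj_imagUnit L) (imagUnit_ne_zero L) hN hJh hJdet).U) (x : ℂ),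
      ω₀ g x = ((1 : (LemD1OfPlace.standingData L v cc N J (complexConj_imagUnit L) (imagUnit_ne_zero L) hN hJh hJdet).U →* ℂˣ) g :
        ℂ) * x := fun g x => by
    rw [MonoidHom.one_apply, Units.val_one, one_mul]; rfl
  let Lf : LemD1IndexedFamily (v.adicCompletion L⁺) (LocalRing L v) N ι :=
    { isNonarchimedeanLocalField := inferInstance
      isModuleTopology := LemD1OfPlace.isModuleTopology_localRing L v
      S := LemD1OfPlace.standingData L v cc N J (complexConj_imagUnit L) (imagUnit_ne_zero L) hN hJh hJdet
      mu := fun _ => μ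
      eps := fun _ => e
      chi := fun _ => χ
      V := fun _ => ℂ
      omega := fun _ => ω₀ }
  have hItem1 : Lf.Item1AsPrinted := fun i =>
    lemD1_1AsPrinted_of_character_of_rank_ne_two' (Lf.single i) 1 hω₀ (fun z => rfl)
      ⟨Set.univ, isOpen_univ, Set.mem_univ _, fun g _ => rfl⟩ hN2
  have hItem3 : LemD1_3AsPrintedI Lf := fun _ i j =>
    iff_of_true (AreIsomorphicRep.refl _) ⟨rfl, ⟨1, by rw [map_one, one_mul, one_mul]⟩, rfl⟩
  exact ⟨Lf, rfl, fun _ => rfl, fun _ => rfl, fun _ => rfl, hItem1, hItem3⟩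

/-- **the `ε`-teeth of (3) at a NON-SPLIT place of `L⁺`, with the rows' own `μ`-slot**: §2c at the Step-2 character
`localMu L (toHeckeCharacter L ψ) v` (packaged by `LemD1OfPlace.muOf` with its displayed proofs): the two-member collection
`(μ_v, e₀, 1), (μ_v, ι_v(a) · e₀, 1)` on the trivial line passes (1) and FAILS `LemD1_3AsPrintedI`. [cite: Liu2021, App. D Lemma D.1 (1) and (3) (l. 5229, 5233)] -/
theorem exists_lemD1IndexedFamily_item1_not_lemD1_3_eps_localMu_of_nonsplit (ψ : IdeleClassGroup L →ₜ* Circle)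
    (hψ : IsConjugateSymplectic L ψ) (w : PlacesOver L v) (hw : cc • w.1 = w.1) (h3 : 3 ≤ N)
    (e₀ : LemD1.EpsRep (LemD1OfPlace.standingData L v cc N J (complexConj_imagUnit L) (imagUnit_ne_zero L) hN hJh hJdet)) :
    ∃ Lf : LemD1IndexedFamily (v.adicCompletion L⁺) (LocalRing L v) N (Fin 2),
      Lf.S = LemD1OfPlace.standingData L v cc N J (complexConj_imagUnit L) (imagUnit_ne_zero L) hN hJh hJdet ∧
      (∀ i, (Lf.mu i).1 = localMu L (toHeckeCharacter L ψ) v) ∧ (∀ i, (Lf.chi i).1 = 1) ∧ (Lf.eps 0).1 = e₀.1 ∧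
      ¬ LemD1.SameClass (Lf.eps 0) (Lf.eps 1) ∧ Lf.Item1AsPrinted ∧ ¬ LemD1_3AsPrintedI Lf :=
  exists_lemD1IndexedFamily_item1_not_lemD1_3_eps_of_nonsplit L v cc (complexConj_imagUnit L) (imagUnit_ne_zero L) N J hN
    hJh hJdet w hw h3
    (LemD1OfPlace.muOf L v cc N J (complexConj_imagUnit L) (imagUnit_ne_zero L) hN hJh hJdet
      (localMu L (toHeckeCharacter L ψ) v)
      (fun x => norm_localMu L (toHeckeCharacter L ψ) v (isUnitary_toHeckeCharacter L ψ) x)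
      (continuous_localMu L (toHeckeCharacter L ψ) v)
      (fun t => localMu_toLocalRing_eq_one_iff L (toHeckeCharacter L ψ) v
        ((isOscillatorChar_toHeckeCharacter_iff ψ).mpr hψ) t))
    e₀

end CM

end Literature.NumberTheory.Automorphic.Liu2021.LemD1IndexedNonVacuityNonsplitPlace

end
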